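import Literature.AnabelianGeometry.SemiGraphs.TemperedCompactPairBridge
import Literature.AnabelianGeometry.SemiGraphs.MetabelianLeafStarPureTypeAnchored
import Literature.AnabelianGeometry.SemiGraphs.MetabelianLeafStarExoticMaximalCompact
import Literature.AnabelianGeometry.SemiGraphs.TemperedAnchoredCompactOfTopCyclic
import Literature.AnabelianGeometry.SemiGraphs.TemperedReconstructionCor39IsoFiniteVertices
import HarnessLib

/-!
# EVERY exotic maximal compact subgroup of `π₁^temp(𝒢⋆(p))` is ISOLATED; [SemiAnbd] Thm 3.7 (iv), SECOND
# SENTENCE, HOLDS IN FULL at the rayless star («EXOTIC-ISOLATION@STAR», file F4 — assembly)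

Mochizuki, *Semi-graphs of anabelioids*, Publ. RIMS **42** (2006), §3, Theorem 3.7 (iv), manuscript p. 41: "The
maximal compact subgroups of `π₁^temp(𝒢)` are precisely the verticial subgroups. The nontrivial intersections of two
distinct maximal compact subgroups of `π₁^temp(𝒢)` are precisely the edge-like subgroups."
[cite: MochizukiSemiAnbd2006, Thm 3.7(iv) p.41].

PROOF-ONLY file (no definition, no named fact; abc-iut cell, layer L3, row «EXOTIC-ISOLATION@STAR», seat
abc-iut-L3-t8 gen 9; gen 8 had the FIRST sentence's counter-example isolated only at the explicit witness `⟨c⟩‾`,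
`MetabelianLeafStarEscapeIsolated.lean`).  At the rayless star `𝒢⋆(p) = metabelianLeafStar p` (every prime `p`),
where the FIRST sentence of Thm 3.7 (iv) FAILS (abc-iut-L3-t8 gen 7, `metabelianLeafStar_not_maximalCompactIffVerticialAt`):

* `exists_forall_mem_fixed_edge_of_forall_not_le` — a compact subgroup lying in no verticial subgroup fixes an edge
  of EVERY level tree (Comments (6)(a): else cofinally one fixed vertex ⇒ verticial);
* **`certificate_of_anchorFree`** — every non-trivial `d` generating a compact anchor-free procyclic subgroup
  carries the FULL EDGE CERTIFICATE «∀ n ∃ M₀ ∀ M ≥ M₀: `d` fixes no edge of `𝒢_{∞,M}` over `n`»: the `a`-character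
  sees `d` (F2); a base edge `n` is GOOD (twisted character sees `d` ⇒ certificate, F2) or BAD (⇒ pure type `n`,
  F2 ⇒ anchored, F3 — impossible);
* **`le_of_isMaximalCompactSubgroup_of_inf_ne_bot_of_forall_not_le`** (ISOLATION, canonical chart) and
  **`metabelianLeafStar_le_of_isMaximalCompactSubgroup_of_inf_ne_bot`** (EVERY chart, by transport of charts): a
  maximal compact subgroup `K₀` lying in no verticial subgroup CONTAINS every compact subgroup meeting it
  non-trivially (two-level bridge, F1); hence meets every OTHER maximal compact subgroup trivially
  (`metabelianLeafStar_inf_eq_bot_of_isMaximalCompactSubgroup_of_ne`), contains every compact-generating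
  element commuting with one of its non-trivial elements, and a non-trivial anchor-free compact subgroup lies in
  at most ONE maximal compact subgroup (`metabelianLeafStar_maximalCompact_eq_of_le_of_le`);
* ★ **`metabelianLeafStar_maximalCompact_inf_iff_edgeLike`** — THM 3.7 (iv), SECOND SENTENCE, AT `𝒢⋆(p)`, EVERY
  CHART: a non-trivial subgroup is the intersection of two distinct maximal compact subgroups iff it is an
  edge-like subgroup of a closed edge (anchored pairs: abc-iut-w6-d064's `TemperedAnchoredCompactOfTopCyclic`;
  exotic members excluded by isolation); `metabelianLeafStar_thm37iv_sentences` — «sentence 1 ✗ ∧ sentence 2 ✓».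

Honest framing: statements about OUR typed `π₁^temp` of OUR countable carrier `𝒢⋆(p)` (NOT locally finite); print's
Thm 3.7 (iv) concerns the graphs of [SemiAnbd] and is untouched; nothing here bears on [IUTchIII] Cor. 3.12; no
side taken; typed ≠ proved.
-/

noncomputable section

open CategoryTheory Topology Multiplicative Filter

namespace Literature.AnabelianGeometry.SemiGraphs

open IwahoriWitness

namespace ProfiniteSemiGraph

variable {p : ℕ} [hp : Fact p.Prime] {h36 : (metabelianLeafStar p).Prop36Hypotheses}

/-- All branches of `𝔾⋆` abut (the star has no open edges). [cite: MochizukiSemiAnbd2006, §1 p.11] -/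
theorem metabelianLeafStar_forall_abuts (p : ℕ) [Fact p.Prime] :
    ∀ b : (metabelianLeafStar p).graph.Branch, ∃ w : (metabelianLeafStar p).graph.Vertex,
      (metabelianLeafStar p).graph.abuts b = some w := by
  rintro ⟨m, b⟩
  cases b
  · exact ⟨_, leafStar_abuts_false' p m⟩
  · exact ⟨_, leafStar_abuts_true' p m⟩

/-! ### Anchor-free compact subgroups fix edges at every level -/

/-- **A compact subgroup of `π₁^temp(𝒢⋆(p))` lying in no verticial subgroup fixes an edge of every level tree**
(canonical chart): otherwise, by the author's Comments (6)(a) (`conj1_of_caseB`), cofinally many levels carry at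
most one fixed vertex and the subgroup would be verticial; two fixed vertices give a fixed edge (Lemma 1.8 (ii)(b)),
pushed down along the transition maps. [cite: MochizukiSemiAnbd2006, Thm 3.7(iii) pp.40-41] -/
theorem exists_forall_mem_fixed_edge_of_forall_not_le (C : Subgroup ((metabelianLeafStar p).temperedPiChart h36).G)
    (hC : IsCompact (C : Set ((metabelianLeafStar p).temperedPiChart h36).G))
    (hno : ∀ (v : (metabelianLeafStar p).graph.Vertex) (H : Subgroup ((metabelianLeafStar p).temperedPiChart h36).G),
      H ∈ verticialSubgroups ((metabelianLeafStar p).temperedPiChart h36) v → ¬ C ≤ H) (i : ℕ) :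
    ∃ ε : (((metabelianLeafStar p).galoisLevelData h36).tree i).Edge,
      ∀ k ∈ C, (((metabelianLeafStar p).galoisLevelData h36).treeAct h36.isCountable i k).hom.edgeMap ε = ε := by
  classical
  let Dg := (metabelianLeafStar p).galoisLevelData h36
  have hc := h36.isCountable
  let D₀ : VerticialLevelData.{0} (metabelianLeafStar p) ((metabelianLeafStar p).temperedPiChart h36) :=
    verticialLevelData_temperedPiChart (h36 := h36)
  by_contra hne
  push Not at hne
  obtain ⟨v, H, hH, hle⟩ := D₀.conj1_of_caseB C hC fun hB => False.elim (by
    obtain ⟨s, hs, his⟩ := hB i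
    rw [Set.not_subsingleton_iff] at hs
    obtain ⟨y, hy, w, hw, hyw⟩ := hs
    obtain ⟨b, -, hb⟩ := D₀.exists_forall_mem_fixed_edge_of_two_fixed_vertices C s hyw
      (fun k hk => hy ⟨k, hk⟩) (fun k hk => hw ⟨k, hk⟩)
    obtain ⟨k, hk, hkne⟩ := hne ((Dg.treeTrans his).edgeMap ((Dg.tree s).edgeOf b))
    have hfix : (Dg.treeAct hc s k).hom.edgeMap ((Dg.tree s).edgeOf b) = (Dg.tree s).edgeOf b := hb k hk
    have h : (Dg.treeTrans his).edgeMap ((Dg.treeAct hc s k).hom.edgeMap ((Dg.tree s).edgeOf b)) =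
        (Dg.treeAct hc i k).hom.edgeMap ((Dg.treeTrans his).edgeMap ((Dg.tree s).edgeOf b)) :=
      D₀.trans_act_edgeMap his k _
    rw [hfix] at h
    exact hkne h.symm)
  exact hno v H hH hle

/-! ### The full edge certificate of an anchor-free compact-generating element -/

/-- **EVERY non-trivial element of `π₁^temp(𝒢⋆(p))` generating a compact procyclic subgroup that lies in no
verticial subgroup carries the FULL EDGE CERTIFICATE** (canonical chart): for every base edge `n` there is a level
`M₀` such that for all `M ≥ M₀` the element fixes no edge of `𝒢_{∞,M}` over `n`.  The `a`-character sees `d` (file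
F2); if the twisted character `(pⁿ, −1)` modulo `p^{n+e₀+1}` sees `d` the certificate is F2's; if not, every
`d`-fixed edge of deep levels lies over `n` (F2) and `d` would be ANCHORED (F3) — excluded.
[cite: MochizukiSemiAnbd2006, Thm 3.7(iv) p.41] -/
theorem certificate_of_anchorFree (d : ((metabelianLeafStar p).galoisLevelData h36).temperedPi h36.isCountable)
    (hdc : IsCompact ((Subgroup.zpowers d).topologicalClosure :
      Set (((metabelianLeafStar p).galoisLevelData h36).temperedPi h36.isCountable)))
    (hno : ∀ (v : (metabelianLeafStar p).graph.Vertex) (H : Subgroup ((metabelianLeafStar p).temperedPiChart h36).G),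
      H ∈ verticialSubgroups ((metabelianLeafStar p).temperedPiChart h36) v →
        ¬ ((Subgroup.zpowers d).topologicalClosure :
            Subgroup (((metabelianLeafStar p).galoisLevelData h36).temperedPi h36.isCountable)) ≤ H)
    (hd1 : d ≠ 1) (n : ℕ) :
    ∃ M₀ : ℕ, ∀ M, M₀ ≤ M → ∀ ε : (((metabelianLeafStar p).galoisLevelData h36).tree M).Edge,
      (((metabelianLeafStar p).galoisLevelData h36).treeProj M).edgeMap ε = n →
        (((metabelianLeafStar p).galoisLevelData h36).treeAct h36.isCountable M d).hom.edgeMap ε ≠ ε := by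
  haveI : NeZero p := ⟨hp.out.ne_zero⟩
  obtain ⟨P₀⟩ := GaloisLevelData.nonempty_pointSeq h36 (leafStarCentre p)
  have hfix : ∀ i, ∃ ε : (((metabelianLeafStar p).galoisLevelData h36).tree i).Edge,
      (((metabelianLeafStar p).galoisLevelData h36).treeAct h36.isCountable i d).hom.edgeMap ε = ε := by
    intro i
    obtain ⟨ε, hε⟩ := exists_forall_mem_fixed_edge_of_forall_not_le (h36 := h36) _ hdc hno i
    have hdC : d ∈ (Subgroup.zpowers d).topologicalClosure := Subgroup.le_topologicalClosure _ (Subgroup.mem_zpowers d)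
    exact ⟨ε, hε d hdC⟩
  obtain ⟨e₀, Φ₀, j₁, hΦ₀P, hΦ₀L, hker₀, hΦ₀d⟩ :=
    exists_aCharacter_ne_one_of_fixes_edges P₀ d hd1 0 (fun M _ => hfix M)
  obtain ⟨Φₙ, jₙ, hΦₙP, -, hkerₙ⟩ :=
    exists_linCharacter₂ h36 (n + e₀ + 1) ((p : ZMod (p ^ (n + e₀ + 1))) ^ n) (-1)
  by_cases hgood : Φₙ d ≠ 1
  · exact ⟨jₙ, fun M hM ε hεn => forall_edgeMap_ne_of_twistCharacter_ne_one P₀ n Φₙ hΦₙP hkerₙ d hgood M hM ε hεn⟩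
  · exfalso
    push Not at hgood
    have hpure : ∀ i, max j₁ jₙ ≤ i → ∀ ε : (((metabelianLeafStar p).galoisLevelData h36).tree i).Edge,
        (((metabelianLeafStar p).galoisLevelData h36).treeAct h36.isCountable i d).hom.edgeMap ε = ε →
          (((metabelianLeafStar p).galoisLevelData h36).treeProj i).edgeMap ε = n := fun i hi ε hε =>
      treeProj_edgeMap_eq_of_twistCharacter_eq_one P₀ n Φ₀ hΦ₀P Φₙ hΦₙP (hker₀ i ((le_max_left _ _).trans hi))
        (hkerₙ i ((le_max_right _ _).trans hi)) d hΦ₀d hgood ε hε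
    obtain ⟨v, H, hH, hle⟩ := exists_verticial_ge_zpowers_of_pure P₀ n d (max j₁ jₙ) (fun i _ => hfix i) hpure Φ₀
      hΦ₀L hker₀ hΦ₀d
    exact hno v H hH hle

/-! ### ISOLATION of every exotic maximal compact subgroup (canonical chart) -/

/-- **ISOLATION (canonical chart).**  A maximal compact subgroup `K₀` of `π₁^temp(𝒢⋆(p))` lying in NO verticial
subgroup CONTAINS every compact subgroup `K` with `K ⊓ K₀ ≠ 1`: a non-trivial `d ∈ K ⊓ K₀` generates a compact
anchor-free `⟨d⟩‾ ≤ K₀` (anchor-free since `K₀` meets every verticial subgroup trivially, abc-iut-w6-d064), which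
carries the full edge certificate; the two-level bridge (`le_of_isMaximalCompactSubgroup_of_certificate`, F1)
concludes. [cite: MochizukiSemiAnbd2006, Thm 3.7(iv) p.41] -/
theorem le_of_isMaximalCompactSubgroup_of_inf_ne_bot_of_forall_not_le
    (K₀ K : Subgroup ((metabelianLeafStar p).temperedPiChart h36).G) (hK₀ : IsMaximalCompactSubgroup K₀)
    (hK₀no : ∀ (v : (metabelianLeafStar p).graph.Vertex) (H : Subgroup ((metabelianLeafStar p).temperedPiChart h36).G),
      H ∈ verticialSubgroups ((metabelianLeafStar p).temperedPiChart h36) v → ¬ K₀ ≤ H)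
    (hK : IsCompact (K : Set ((metabelianLeafStar p).temperedPiChart h36).G)) (hKK₀ : K ⊓ K₀ ≠ ⊥) : K ≤ K₀ := by
  haveI : T2Space ((metabelianLeafStar p).temperedPiChart h36).G :=
    ((metabelianLeafStar p).galoisLevelData h36).t2Space_temperedPi h36.isCountable
  haveI : T2Space (((metabelianLeafStar p).galoisLevelData h36).temperedPi h36.isCountable) :=
    ((metabelianLeafStar p).galoisLevelData h36).t2Space_temperedPi h36.isCountable
  obtain ⟨d, hdmem, hd1⟩ : ∃ d ∈ K ⊓ K₀, d ≠ 1 := by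
    by_contra h
    push Not at h
    exact hKK₀ ((Subgroup.eq_bot_iff_forall _).mpr h)
  obtain ⟨hdK, hdK₀⟩ := Subgroup.mem_inf.mp hdmem
  -- read everything in the tower's group
  obtain ⟨d₁, rfl⟩ : ∃ d₁ : ((metabelianLeafStar p).galoisLevelData h36).temperedPi h36.isCountable, d₁ = d := ⟨d, rfl⟩
  obtain ⟨K₁, rfl⟩ :
      ∃ K₁ : Subgroup (((metabelianLeafStar p).galoisLevelData h36).temperedPi h36.isCountable), K₁ = K := ⟨K, rfl⟩
  obtain ⟨K₂, rfl⟩ :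
      ∃ K₂ : Subgroup (((metabelianLeafStar p).galoisLevelData h36).temperedPi h36.isCountable), K₂ = K₀ := ⟨K₀, rfl⟩
  have hK₁c : IsCompact (K₁ : Set (((metabelianLeafStar p).galoisLevelData h36).temperedPi h36.isCountable)) := hK
  let D : Subgroup (((metabelianLeafStar p).galoisLevelData h36).temperedPi h36.isCountable) :=
    (Subgroup.zpowers d₁).topologicalClosure
  have hK₂c : IsCompact (K₂ : Set (((metabelianLeafStar p).galoisLevelData h36).temperedPi h36.isCountable)) := hK₀.1
  have hK₂cl : IsClosed (K₂ : Set (((metabelianLeafStar p).galoisLevelData h36).temperedPi h36.isCountable)) :=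
    hK₂c.isClosed
  have hDK₀ : D ≤ K₂ := Subgroup.topologicalClosure_minimal _ (Subgroup.zpowers_le.mpr hdK₀) hK₂cl
  have hDcl : IsClosed (D : Set (((metabelianLeafStar p).galoisLevelData h36).temperedPi h36.isCountable)) :=
    Subgroup.isClosed_topologicalClosure _
  have hDc : IsCompact (D : Set (((metabelianLeafStar p).galoisLevelData h36).temperedPi h36.isCountable)) :=
    hK₂c.of_isClosed_subset hDcl hDK₀
  have hK₀af := fun v H hH =>
    metabelianLeafStar_inf_verticial_eq_bot_of_forall_not_le p ((metabelianLeafStar p).temperedPiChart h36) K₂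
      hK₀.1 hK₀no (v₀ := v) (H₀ := H) hH
  have hDno : ∀ (v : (metabelianLeafStar p).graph.Vertex) (H : Subgroup ((metabelianLeafStar p).temperedPiChart h36).G),
      H ∈ verticialSubgroups ((metabelianLeafStar p).temperedPiChart h36) v → ¬ D ≤ H := by
    intro v H hH hle
    have hdD : d₁ ∈ D := Subgroup.le_topologicalClosure _ (Subgroup.mem_zpowers d₁)
    have hd : d₁ ∈ (K₂ ⊓ H : Subgroup ((metabelianLeafStar p).temperedPiChart h36).G) :=
      Subgroup.mem_inf.mpr ⟨hdK₀, hle hdD⟩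
    exact hd1 ((Subgroup.eq_bot_iff_forall _).mp (hK₀af v H hH) d₁ hd)
  have hcert := certificate_of_anchorFree (h36 := h36) d₁ hDc hDno hd1
  exact le_of_isMaximalCompactSubgroup_of_certificate h36 (metabelianLeafStar_forall_abuts p) K₁ K₂ hK₁c hK₀ hdK
    hdK₀ (fun n => hcert n)

/-! ### ISOLATION at every chart -/

variable (p)

/-- **ISOLATION at EVERY chart of `π₁^temp(𝒢⋆(p))`**: a maximal compact subgroup lying in no verticial subgroup
contains every compact subgroup meeting it non-trivially (transport of the canonical-chart statement along the
compatible isomorphism of charts, `TemperedPiChart.exists_compatIso`, `mem_verticialSubgroups_iff_map`).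
[cite: MochizukiSemiAnbd2006, Thm 3.7(iv) p.41] -/
theorem metabelianLeafStar_le_of_isMaximalCompactSubgroup_of_inf_ne_bot (c : TemperedPiChart (metabelianLeafStar p))
    (K₀ K : Subgroup c.G) (hK₀ : IsMaximalCompactSubgroup K₀)
    (hK₀no : ∀ (v : (metabelianLeafStar p).graph.Vertex) (H : Subgroup c.G), H ∈ verticialSubgroups c v → ¬ K₀ ≤ H)
    (hK : IsCompact (K : Set c.G)) (hKK₀ : K ⊓ K₀ ≠ ⊥) : K ≤ K₀ := by
  have h36 : (metabelianLeafStar p).Prop36Hypotheses := (metabelianLeafStar_thm37Hypotheses' p).toProp36Hypotheses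
  obtain ⟨φ, ψ, hψφ, hφψ, hφ, hψ⟩ := TemperedPiChart.exists_compatIso ((metabelianLeafStar p).temperedPiChart h36) c
  let e : c.G ≃ₜ* ((metabelianLeafStar p).temperedPiChart h36).G :=
    { toFun := ψ, invFun := φ, left_inv := hφψ, right_inv := hψφ, map_mul' := map_mul ψ,
      continuous_toFun := ψ.continuous, continuous_invFun := φ.continuous }
  have he : e.toMonoidHom = ψ.toMonoidHom := rfl
  have hback : ∀ H : Subgroup c.G, (H.map ψ.toMonoidHom).map φ.toMonoidHom = H := by
    intro H
    ext y
    constructor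
    · rintro ⟨_, ⟨z, hz, rfl⟩, rfl⟩
      rw [show φ.toMonoidHom (ψ.toMonoidHom z) = z from hφψ z]; exact hz
    · intro hy
      exact ⟨ψ y, ⟨y, hy, rfl⟩, hφψ y⟩
  -- transport the data to the canonical chart
  have hK₀' : IsMaximalCompactSubgroup (K₀.map ψ.toMonoidHom) := by
    rw [← he]; exact IsMaximalCompactSubgroup.map_equiv e hK₀
  have hK₀no' : ∀ (v : (metabelianLeafStar p).graph.Vertex)
      (H : Subgroup ((metabelianLeafStar p).temperedPiChart h36).G),
      H ∈ verticialSubgroups ((metabelianLeafStar p).temperedPiChart h36) v → ¬ K₀.map ψ.toMonoidHom ≤ H := by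
    intro v H hH hle
    refine hK₀no v (H.map φ.toMonoidHom) (mem_verticialSubgroups_map φ hφ hH) ?_
    rw [← hback K₀]
    exact Subgroup.map_mono hle
  have hK' : IsCompact ((K.map ψ.toMonoidHom : Subgroup _) : Set ((metabelianLeafStar p).temperedPiChart h36).G) := by
    rw [Subgroup.coe_map]; exact hK.image ψ.continuous
  have hKK₀' : K.map ψ.toMonoidHom ⊓ K₀.map ψ.toMonoidHom ≠ ⊥ := by
    obtain ⟨d, hdmem, hd1⟩ : ∃ d ∈ K ⊓ K₀, d ≠ 1 := by
      by_contra h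
      push Not at h
      exact hKK₀ ((Subgroup.eq_bot_iff_forall _).mpr h)
    obtain ⟨hdK, hdK₀⟩ := Subgroup.mem_inf.mp hdmem
    intro hbot
    have hmem : ψ d ∈ K.map ψ.toMonoidHom ⊓ K₀.map ψ.toMonoidHom := ⟨⟨d, hdK, rfl⟩, ⟨d, hdK₀, rfl⟩⟩
    rw [hbot, Subgroup.mem_bot] at hmem
    apply hd1
    rw [← hφψ d, show ψ d = 1 from hmem, map_one]
  have hle := le_of_isMaximalCompactSubgroup_of_inf_ne_bot_of_forall_not_le (h36 := h36) _ _ hK₀' hK₀no' hK' hKK₀'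
  intro x hx
  obtain ⟨y, hy, hyx⟩ := hle ⟨x, hx, rfl⟩
  have : y = x := by rw [← hφψ y, ← hφψ x]; exact congrArg φ hyx
  exact this ▸ hy

/-- **Two DISTINCT maximal compact subgroups of `π₁^temp(𝒢⋆(p))`, one of which lies in no verticial subgroup, meet
TRIVIALLY** (every chart). [cite: MochizukiSemiAnbd2006, Thm 3.7(iv) p.41] -/
theorem metabelianLeafStar_inf_eq_bot_of_isMaximalCompactSubgroup_of_ne (c : TemperedPiChart (metabelianLeafStar p))
    (K₀ K : Subgroup c.G) (hK₀ : IsMaximalCompactSubgroup K₀) (hK : IsMaximalCompactSubgroup K)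
    (hK₀no : ∀ (v : (metabelianLeafStar p).graph.Vertex) (H : Subgroup c.G), H ∈ verticialSubgroups c v → ¬ K₀ ≤ H)
    (hne : K ≠ K₀) : K ⊓ K₀ = ⊥ := by
  by_contra h
  exact hne (hK.2 _ hK₀.1 (metabelianLeafStar_le_of_isMaximalCompactSubgroup_of_inf_ne_bot p c K₀ K hK₀ hK₀no hK.1 h)).symm

/-- **A compact-generating element commuting with a non-trivial element of an exotic maximal compact subgroup lies in
it** (every chart; gen 8's `mem_escape_of_commute_of_mem` for ALL exotic maximal compact subgroups): `⟨k, d⟩‾` is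
compact (commuting pair) and meets `K₀` in `d ≠ 1`. [cite: MochizukiSemiAnbd2006, Thm 3.7(iv) p.41] -/
theorem metabelianLeafStar_mem_of_commute_of_mem (c : TemperedPiChart (metabelianLeafStar p))
    (K₀ : Subgroup c.G) (hK₀ : IsMaximalCompactSubgroup K₀)
    (hK₀no : ∀ (v : (metabelianLeafStar p).graph.Vertex) (H : Subgroup c.G), H ∈ verticialSubgroups c v → ¬ K₀ ≤ H)
    (k d : c.G) (hk : IsCompact ((Subgroup.zpowers k).topologicalClosure : Set c.G)) (hd : d ∈ K₀) (hd1 : d ≠ 1)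
    (hkd : k * d = d * k) : k ∈ K₀ := by
  haveI := c.t2Space
  have hdc : IsCompact ((Subgroup.zpowers d).topologicalClosure : Set c.G) :=
    hK₀.1.of_isClosed_subset (Subgroup.isClosed_topologicalClosure _)
      (Subgroup.topologicalClosure_minimal _ (Subgroup.zpowers_le.mpr hd) hK₀.1.isClosed)
  have hcpt := isCompact_topologicalClosure_closure_pair_of_commute hk hdc hkd
  have hle := metabelianLeafStar_le_of_isMaximalCompactSubgroup_of_inf_ne_bot p c K₀ _ hK₀ hK₀no hcpt (by
    intro hbot
    have hmem : d ∈ (Subgroup.closure ({k, d} : Set c.G)).topologicalClosure ⊓ K₀ :=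
      ⟨Subgroup.le_topologicalClosure _ (Subgroup.subset_closure (by simp)), hd⟩
    rw [hbot, Subgroup.mem_bot] at hmem
    exact hd1 hmem)
  exact hle (Subgroup.le_topologicalClosure _ (Subgroup.subset_closure (by simp)))

/-- **A non-trivial compact subgroup lying in no verticial subgroup lies in AT MOST ONE maximal compact
subgroup** (every chart): two maximal compact subgroups containing it coincide (both lie in no verticial subgroup —
an anchor would anchor `K`, which meets every verticial subgroup trivially, abc-iut-w6-d064 — and ISOLATION).
[cite: MochizukiSemiAnbd2006, Thm 3.7(iv) p.41] -/
theorem metabelianLeafStar_maximalCompact_eq_of_le_of_le (c : TemperedPiChart (metabelianLeafStar p))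
    (K K₁ K₂ : Subgroup c.G) (hKc : IsCompact (K : Set c.G)) (hKne : K ≠ ⊥)
    (hKno : ∀ (v : (metabelianLeafStar p).graph.Vertex) (H : Subgroup c.G), H ∈ verticialSubgroups c v → ¬ K ≤ H)
    (hK₁ : IsMaximalCompactSubgroup K₁) (hK₂ : IsMaximalCompactSubgroup K₂) (h₁ : K ≤ K₁) (h₂ : K ≤ K₂) :
    K₁ = K₂ := by
  have hK₁no : ∀ (v : (metabelianLeafStar p).graph.Vertex) (H : Subgroup c.G), H ∈ verticialSubgroups c v →
      ¬ K₁ ≤ H := by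
    intro v H hH hle
    have hbot := metabelianLeafStar_inf_verticial_eq_bot_of_forall_not_le p c K hKc hKno hH
    exact hKne (le_bot_iff.mp (hbot ▸ le_inf le_rfl (h₁.trans hle)))
  by_contra hne
  have hbot := metabelianLeafStar_inf_eq_bot_of_isMaximalCompactSubgroup_of_ne p c K₁ K₂ hK₁ hK₂ hK₁no (Ne.symm hne)
  exact hKne (le_bot_iff.mp (hbot ▸ le_inf h₂ h₁))

/-! ### ★ Thm 3.7 (iv), SECOND SENTENCE, at `𝒢⋆(p)`, every chart -/

/-- ★ **[SemiAnbd] Thm 3.7 (iv), SECOND SENTENCE, HOLDS at the rayless star `𝒢⋆(p)`, at every chart, for every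
prime `p`**: a non-trivial subgroup `L ≤ π₁^temp(𝒢⋆(p))` is the intersection of two distinct maximal compact
subgroups iff it is an edge-like subgroup of a closed edge.  «⇐» and the ANCHORED «⇒» are abc-iut-w6-d064's
`TemperedAnchoredCompactOfTopCyclic` (edge groups `ℤ_p` topologically cyclic; Thm 3.7 hypotheses
`metabelianLeafStar_thm37Hypotheses'`); an EXOTIC member of the pair is excluded by ISOLATION.
[cite: MochizukiSemiAnbd2006, Thm 3.7(iv) p.41] -/
theorem metabelianLeafStar_maximalCompact_inf_iff_edgeLike (c : TemperedPiChart (metabelianLeafStar p))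
    (L : Subgroup c.G) (hL : L ≠ ⊥) :
    (∃ K₁ K₂ : Subgroup c.G, IsMaximalCompactSubgroup K₁ ∧ IsMaximalCompactSubgroup K₂ ∧ K₁ ≠ K₂ ∧ L = K₁ ⊓ K₂) ↔
      ∃ e, (metabelianLeafStar p).graph.IsClosedEdge e ∧ L ∈ edgeLikeSubgroups c e := by
  have h37 := metabelianLeafStar_thm37Hypotheses' p
  have hcyc : ∀ e : (metabelianLeafStar p).graph.Edge, ∃ t₀ : (metabelianLeafStar p).Ge e,
      (Subgroup.zpowers t₀).topologicalClosure = ⊤ :=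
    fun _ => ⟨ofAdd (1 : ℤ_[p]), FreeProPRankTwo.topologicalClosure_zpowers_ofAdd_one p⟩
  constructor
  · rintro ⟨K₁, K₂, hK₁, hK₂, hne, rfl⟩
    -- neither member is exotic
    have hanch : ∀ {K K' : Subgroup c.G}, IsMaximalCompactSubgroup K → IsMaximalCompactSubgroup K' → K ≠ K' →
        K ⊓ K' ≠ ⊥ → ∃ (v : (metabelianLeafStar p).graph.Vertex) (H : Subgroup c.G),
          H ∈ verticialSubgroups c v ∧ K ≤ H := by
      intro K K' hK hK' hKK' hbot
      by_contra hno
      push Not at hno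
      exact hbot ((inf_comm K K').trans
        (metabelianLeafStar_inf_eq_bot_of_isMaximalCompactSubgroup_of_ne p c K K' hK hK'
          (fun v H hH hle => hno v H hH hle) hKK'.symm))
    obtain ⟨v₁, H₁, hH₁, hK₁H₁⟩ := hanch hK₁ hK₂ hne hL
    exact (metabelianLeafStar p).exists_mem_edgeLikeSubgroups_of_maximalCompact_inf_of_anchored_of_topCyclic h37 hcyc
      c hK₁ hK₂ hne hL hH₁ (fun h => hL (le_bot_iff.mp (h ▸ le_inf inf_le_left (inf_le_left.trans hK₁H₁))))
  · rintro ⟨e, he, hLe⟩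
    exact (metabelianLeafStar p).exists_maximalCompact_inf_eq_of_mem_edgeLikeSubgroups_of_topCyclic h37 hcyc c he hLe hL

/-- **THE TWO SENTENCES OF THM 3.7 (iv) AT `𝒢⋆(p)`: the first FAILS, the second HOLDS** (the typed per-graph
predicate `MaximalCompactIffVerticialAt (𝒢⋆(p))` is false, abc-iut-L3-t8 gen 7, through its first clause only).
[cite: MochizukiSemiAnbd2006, Thm 3.7(iv) p.41] -/
theorem metabelianLeafStar_thm37iv_sentences :
    ¬ MaximalCompactIffVerticialAt (metabelianLeafStar p) ∧
      ∀ (c : TemperedPiChart (metabelianLeafStar p)) (L : Subgroup c.G), L ≠ ⊥ →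
        ((∃ K₁ K₂ : Subgroup c.G, IsMaximalCompactSubgroup K₁ ∧ IsMaximalCompactSubgroup K₂ ∧ K₁ ≠ K₂ ∧
            L = K₁ ⊓ K₂) ↔ ∃ e, (metabelianLeafStar p).graph.IsClosedEdge e ∧ L ∈ edgeLikeSubgroups c e) :=
  ⟨metabelianLeafStar_not_maximalCompactIffVerticialAt p, metabelianLeafStar_maximalCompact_inf_iff_edgeLike p⟩

end ProfiniteSemiGraph

end Literature.AnabelianGeometry.SemiGraphs

end
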